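import Mathlib
import Summits.Ventures.PercRepro2.Defs
import Summits.Ventures.PercRepro2.Harris
import Summits.Ventures.PercRepro2.CoinDefs
import Summits.Ventures.PercRepro2.CoinReverse
import Summits.Ventures.PercRepro2.CoinLsmCoreDefs
import Summits.Ventures.PercRepro2.CoinLsmCoreU
import Summits.Ventures.PercRepro2.CoinSquareCoreDefs

/-!
# The mixed 4-cycle core with one one-way arc into the tail (blind cell PercRepro2, night-2 g8;
proofs/NIGHT2-DARC.md §33)

`MixedCore arcs s p q a c₁ c₂ c₃ c₄`: the pair-coins `c₁ = s ↔ p`, `c₂ = s ↔ q`, `c₃ = p ↔ a` and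
the single-arc coin `c₄ = q → a` are the ONLY coins with an arc into `{s, p, q, a}`.  Reachability:
`s ⇝ p ⟺ α ∨ βδγ`, `s ⇝ q ⟺ β`, `s ⇝ a ⟺ αγ ∨ βδ`; the core levels are unions of the cylinders
of the four coins (`prob_level`), with `ν(∅) = (1−α)(1−β)`, `ν(p) = α(1−β)(1−γ)`,
`ν(q) = (1−α)β(1−δ)`, `ν(pq) = αβ(1−γ)(1−δ)`, `ν(a) = 0`, `ν(pa) = α(1−β)γ`,
`ν(qa) = (1−α)β(1−γ)δ`, `ν(pqa) = αβ(γ + δ − γδ) + (1−α)βγδ`.  One of the twelve orientations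
of the 4-cycle on which the cell split fails (§32.1).
-/

namespace Summit.Ventures.PercRepro2.Coin

open Classical

section MixedCoreDefs

variable {V : Type*} {E : Type*} [DecidableEq V]

/-- The mixed 4-cycle core: three pair-coins, the one-way coin `q → a`, and «no other coin enters
`{s, p, q, a}`». -/
structure MixedCore (arcs : E → Finset (V × V)) (s p q a : V) (c₁ c₂ c₃ c₄ : E) : Prop where
  arc₁ : arcs c₁ = {(s, p), (p, s)}
  arc₂ : arcs c₂ = {(s, q), (q, s)}
  arc₃ : arcs c₃ = {(p, a), (a, p)}
  arc₄ : arcs c₄ = {(q, a)}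
  core : ∀ e, ∀ xy ∈ arcs e, (xy.2 = s ∨ xy.2 = p ∨ xy.2 = q ∨ xy.2 = a) →
    e = c₁ ∨ e = c₂ ∨ e = c₃ ∨ e = c₄
  sp : s ≠ p
  sq : s ≠ q
  sa : s ≠ a
  pq : p ≠ q
  pa : p ≠ a
  qa : q ≠ a

variable {arcs : E → Finset (V × V)} {s p q a : V} {c₁ c₂ c₃ c₄ : E}

/-- The square core is closed in (relaxed sense: arcs into `s` from the core are allowed). -/
theorem MixedCore.closedInCoreU (h : MixedCore arcs s p q a c₁ c₂ c₃ c₄) :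
    ClosedInCoreU arcs s {p, q, a} := by
  refine ⟨?_, ?_, ?_⟩
  · intro e xy hxy hy
    simp only [Finset.mem_insert, Finset.mem_singleton] at hy
    have hc := h.core e xy hxy (by tauto)
    simp only [Finset.mem_insert, Finset.mem_singleton]
    rcases hc with rfl | rfl | rfl | rfl
    · rw [h.arc₁] at hxy; simp only [Finset.mem_insert, Finset.mem_singleton] at hxy
      rcases hxy with rfl | rfl <;> simp
    · rw [h.arc₂] at hxy; simp only [Finset.mem_insert, Finset.mem_singleton] at hxy
      rcases hxy with rfl | rfl <;> simp
    · rw [h.arc₃] at hxy; simp only [Finset.mem_insert, Finset.mem_singleton] at hxy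
      rcases hxy with rfl | rfl <;> simp
    · rw [h.arc₄, Finset.mem_singleton] at hxy; subst hxy; simp
  · intro e xy hxy hy
    have hc := h.core e xy hxy (Or.inl hy)
    simp only [Finset.mem_insert, Finset.mem_singleton]
    rcases hc with rfl | rfl | rfl | rfl
    · rw [h.arc₁] at hxy; simp only [Finset.mem_insert, Finset.mem_singleton] at hxy
      rcases hxy with rfl | rfl <;> simp
    · rw [h.arc₂] at hxy; simp only [Finset.mem_insert, Finset.mem_singleton] at hxy
      rcases hxy with rfl | rfl <;> simp
    · rw [h.arc₃] at hxy; simp only [Finset.mem_insert, Finset.mem_singleton] at hxy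
      rcases hxy with rfl | rfl <;> simp
    · rw [h.arc₄, Finset.mem_singleton] at hxy; subst hxy; simp
  · simp only [Finset.mem_insert, Finset.mem_singleton, not_or]
    exact ⟨h.sp, h.sq, h.sa⟩

/-- **The closure lemma of the square**: if `Z ⊆ {p, q, a}` and no OPEN pair-coin carries an arc
from outside `Z` into `Z`, then nothing reachable from `s` lies in `Z`. -/
lemma MixedCore.not_reach_of_closed (h : MixedCore arcs s p q a c₁ c₂ c₃ c₄) {ω : Config E}
    {Z : Set V} (hZs : s ∉ Z) (hZ : ∀ v ∈ Z, v = p ∨ v = q ∨ v = a)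
    (h₁ : ω c₁ = true → ∀ xy ∈ arcs c₁, xy.2 ∈ Z → xy.1 ∈ Z)
    (h₂ : ω c₂ = true → ∀ xy ∈ arcs c₂, xy.2 ∈ Z → xy.1 ∈ Z)
    (h₃ : ω c₃ = true → ∀ xy ∈ arcs c₃, xy.2 ∈ Z → xy.1 ∈ Z)
    (h₄ : ω c₄ = true → ∀ xy ∈ arcs c₄, xy.2 ∈ Z → xy.1 ∈ Z)
    {y : V} (hy : y ∈ Z) : ¬ Reach arcs ω s y := by
  intro hr
  have key := reach_mem_of_closed (U := Zᶜ) ?_ hZs hr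
  · exact key hy
  · intro e he xy hxy hx hy'
    have hc := h.core e xy hxy (by rcases hZ _ hy' with h' | h' | h' <;> simp [h'])
    rcases hc with rfl | rfl | rfl | rfl
    · exact hx (h₁ he xy hxy hy')
    · exact hx (h₂ he xy hxy hy')
    · exact hx (h₃ he xy hxy hy')
    · exact hx (h₄ he xy hxy hy')

/-- `s ⇝ p` iff `α` is open or the route `β, δ, γ` is open. -/
theorem MixedCore.reach_p_iff (h : MixedCore arcs s p q a c₁ c₂ c₃ c₄) (ω : Config E) :
    Reach arcs ω s p ↔ ω c₁ = true ∨ (ω c₂ = true ∧ ω c₄ = true ∧ ω c₃ = true) := by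
  have hps : p ≠ s := h.sp.symm
  have hqs : q ≠ s := h.sq.symm
  have has : a ≠ s := h.sa.symm
  have hqp : q ≠ p := h.pq.symm
  have hap : a ≠ p := h.pa.symm
  have haq : a ≠ q := h.qa.symm
  constructor
  · intro hr
    by_cases hb1 : ω c₁ = true
    · exact Or.inl hb1
    simp only [Bool.not_eq_true] at hb1
    by_cases hb2 : ω c₂ = true
    · by_cases hb4 : ω c₄ = true
      · by_cases hb3 : ω c₃ = true
        · exact Or.inr ⟨hb2, hb4, hb3⟩
        simp only [Bool.not_eq_true] at hb3
        exfalso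
        refine h.not_reach_of_closed (Z := {v | v = p}) (by simp [h.sp]) (by simp) ?_ ?_ ?_ ?_
          (by simp) hr
        · intro h'; simp [hb1] at h'
        · intro _; rw [h.arc₂, pair_closed_iff]; simp [hqp, h.sp]
        · intro h'; simp [hb3] at h'
        · intro _ xy hxy; rw [h.arc₄, Finset.mem_singleton] at hxy; subst hxy; simp [hap]
      · simp only [Bool.not_eq_true] at hb4
        exfalso
        refine h.not_reach_of_closed (Z := {v | v = p ∨ v = a}) (by simp [h.sp, h.sa]) (by simp)
          ?_ ?_ ?_ ?_ (by simp) hr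
        · intro h'; simp [hb1] at h'
        · intro _; rw [h.arc₂, pair_closed_iff]; simp [hqp, h.qa, h.sp, h.sa]
        · intro _; rw [h.arc₃, pair_closed_iff]; simp
        · intro h'; simp [hb4] at h'
    · simp only [Bool.not_eq_true] at hb2
      exfalso
      refine h.not_reach_of_closed (Z := {v | v = p ∨ v = q ∨ v = a}) (by simp [h.sp, h.sq, h.sa])
        (by simp) ?_ ?_ ?_ ?_ (by simp) hr
      · intro h'; simp [hb1] at h'
      · intro h'; simp [hb2] at h'
      · intro _; rw [h.arc₃, pair_closed_iff]; simp
      · intro _ xy hxy; rw [h.arc₄, Finset.mem_singleton] at hxy; subst hxy; simp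
  · rintro (h1 | ⟨h2, h4, h3⟩)
    · exact reach_of_openArc ⟨c₁, h1, by rw [h.arc₁]; simp⟩
    · have r1 : Reach arcs ω s q := reach_of_openArc ⟨c₂, h2, by rw [h.arc₂]; simp⟩
      have r2 : Reach arcs ω q a := reach_of_openArc ⟨c₄, h4, by rw [h.arc₄]; simp⟩
      have r3 : Reach arcs ω a p := reach_of_openArc ⟨c₃, h3, by rw [h.arc₃]; simp⟩
      exact reach_trans r1 (reach_trans r2 r3)

/-- `s ⇝ q` iff `β` is open (the arc `q → a` is one-way). -/
theorem MixedCore.reach_q_iff (h : MixedCore arcs s p q a c₁ c₂ c₃ c₄) (ω : Config E) :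
    Reach arcs ω s q ↔ ω c₂ = true := by
  constructor
  · intro hr
    by_cases hb2 : ω c₂ = true
    · exact hb2
    simp only [Bool.not_eq_true] at hb2
    exfalso
    refine h.not_reach_of_closed (Z := {v | v = q}) (by simp [h.sq]) (by simp) ?_ ?_ ?_ ?_ (by simp) hr
    · intro _; rw [h.arc₁, pair_closed_iff]; simp [h.pq, h.sq]
    · intro h'; simp [hb2] at h'
    · intro _; rw [h.arc₃, pair_closed_iff]; simp [h.pq, h.qa.symm]
    · intro _ xy hxy; rw [h.arc₄, Finset.mem_singleton] at hxy; subst hxy; simp [h.qa.symm]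
  · intro h2
    exact reach_of_openArc ⟨c₂, h2, by rw [h.arc₂]; simp⟩

/-- `s ⇝ a` iff the route `α, γ` or the route `β, δ` is open. -/
theorem MixedCore.reach_a_iff (h : MixedCore arcs s p q a c₁ c₂ c₃ c₄) (ω : Config E) :
    Reach arcs ω s a ↔ (ω c₁ = true ∧ ω c₃ = true) ∨ (ω c₂ = true ∧ ω c₄ = true) := by
  have hqp : q ≠ p := h.pq.symm
  have hap : a ≠ p := h.pa.symm
  have haq : a ≠ q := h.qa.symm
  constructor
  · intro hr
    by_cases h13 : ω c₁ = true ∧ ω c₃ = true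
    · exact Or.inl h13
    by_cases h24 : ω c₂ = true ∧ ω c₄ = true
    · exact Or.inr h24
    exfalso
    by_cases hb1 : ω c₁ = true
    · have hb3 : ω c₃ = false := by
        cases hc : ω c₃
        · rfl
        · exact absurd ⟨hb1, hc⟩ h13
      by_cases hb2 : ω c₂ = true
      · have hb4 : ω c₄ = false := by
          cases hc : ω c₄
          · rfl
          · exact absurd ⟨hb2, hc⟩ h24
        refine h.not_reach_of_closed (Z := {v | v = a}) (by simp [h.sa]) (by simp) ?_ ?_ ?_ ?_
          (by simp) hr
        · intro _; rw [h.arc₁, pair_closed_iff]; simp [h.pa, h.sa]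
        · intro _; rw [h.arc₂, pair_closed_iff]; simp [h.qa, h.sa]
        · intro h'; simp [hb3] at h'
        · intro h'; simp [hb4] at h'
      · simp only [Bool.not_eq_true] at hb2
        refine h.not_reach_of_closed (Z := {v | v = q ∨ v = a}) (by simp [h.sq, h.sa]) (by simp)
          ?_ ?_ ?_ ?_ (by simp) hr
        · intro _; rw [h.arc₁, pair_closed_iff]; simp [h.pq, h.pa, h.sq, h.sa]
        · intro h'; simp [hb2] at h'
        · intro h'; simp [hb3] at h'
        · intro _ xy hxy; rw [h.arc₄, Finset.mem_singleton] at hxy; subst hxy; simp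
    · simp only [Bool.not_eq_true] at hb1
      by_cases hb2 : ω c₂ = true
      · have hb4 : ω c₄ = false := by
          cases hc : ω c₄
          · rfl
          · exact absurd ⟨hb2, hc⟩ h24
        refine h.not_reach_of_closed (Z := {v | v = p ∨ v = a}) (by simp [h.sp, h.sa]) (by simp)
          ?_ ?_ ?_ ?_ (by simp) hr
        · intro h'; simp [hb1] at h'
        · intro _; rw [h.arc₂, pair_closed_iff]; simp [hqp, h.qa, h.sp, h.sa]
        · intro _; rw [h.arc₃, pair_closed_iff]; simp
        · intro h'; simp [hb4] at h'
      · simp only [Bool.not_eq_true] at hb2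
        refine h.not_reach_of_closed (Z := {v | v = p ∨ v = q ∨ v = a})
          (by simp [h.sp, h.sq, h.sa]) (by simp) ?_ ?_ ?_ ?_ (by simp) hr
        · intro h'; simp [hb1] at h'
        · intro h'; simp [hb2] at h'
        · intro _; rw [h.arc₃, pair_closed_iff]; simp
        · intro _ xy hxy; rw [h.arc₄, Finset.mem_singleton] at hxy; subst hxy; simp
  · rintro (⟨h1, h3⟩ | ⟨h2, h4⟩)
    · have r1 : Reach arcs ω s p := reach_of_openArc ⟨c₁, h1, by rw [h.arc₁]; simp⟩
      have r2 : Reach arcs ω p a := reach_of_openArc ⟨c₃, h3, by rw [h.arc₃]; simp⟩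
      exact reach_trans r1 r2
    · have r1 : Reach arcs ω s q := reach_of_openArc ⟨c₂, h2, by rw [h.arc₂]; simp⟩
      have r2 : Reach arcs ω q a := reach_of_openArc ⟨c₄, h4, by rw [h.arc₄]; simp⟩
      exact reach_trans r1 r2

end MixedCoreDefs

section MixedLevels

variable {V : Type*} {E : Type*} [DecidableEq V] [Fintype E] [DecidableEq E]
  {R : Type*} [Field R]
  {arcs : E → Finset (V × V)} {s p q a : V} {c₁ c₂ c₃ c₄ : E}

omit [Fintype E] [DecidableEq E] in
/-- On the cylinder of `b`, membership in the core level of `W` is the Boolean condition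
`(p ∈ W ↔ b₁ ∨ b₂ b₄ b₃) ∧ (q ∈ W ↔ b₂ ∨ b₁ b₃ b₄) ∧ (a ∈ W ↔ b₁ b₃ ∨ b₂ b₄)`. -/
lemma MixedCore.level_inter_cyl (h : MixedCore arcs s p q a c₁ c₂ c₃ c₄) (W : Finset V)
    (b : Bool × Bool × Bool × Bool) :
    coreLevel arcs s {p, q, a} W ∩ {ω | ω c₁ = b.1 ∧ ω c₂ = b.2.1 ∧ ω c₃ = b.2.2.1 ∧ ω c₄ = b.2.2.2}
      = if (p ∈ W ↔ (b.1 = true ∨ (b.2.1 = true ∧ b.2.2.2 = true ∧ b.2.2.1 = true))) ∧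
          (q ∈ W ↔ b.2.1 = true) ∧
          (a ∈ W ↔ ((b.1 = true ∧ b.2.2.1 = true) ∨ (b.2.1 = true ∧ b.2.2.2 = true)))
        then {ω | ω c₁ = b.1 ∧ ω c₂ = b.2.1 ∧ ω c₃ = b.2.2.1 ∧ ω c₄ = b.2.2.2} else ∅ := by
  obtain ⟨b₁, b₂, b₃, b₄⟩ := b
  ext ω
  have hmem : ω ∈ coreLevel arcs s {p, q, a} W ↔
      (p ∈ W ↔ (ω c₁ = true ∨ (ω c₂ = true ∧ ω c₄ = true ∧ ω c₃ = true))) ∧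
        (q ∈ W ↔ ω c₂ = true) ∧
        (a ∈ W ↔ ((ω c₁ = true ∧ ω c₃ = true) ∨ (ω c₂ = true ∧ ω c₄ = true))) := by
    rw [mem_coreLevel]
    simp only [Finset.mem_insert, Finset.mem_singleton, forall_eq_or_imp, forall_eq,
      h.reach_p_iff, h.reach_q_iff, h.reach_a_iff]
  simp only [Set.mem_inter_iff, hmem, Set.mem_setOf_eq]
  split_ifs with hc
  · simp only [Set.mem_setOf_eq]
    constructor
    · rintro ⟨_, hω⟩; exact hω
    · rintro ⟨h1, h2, h3, h4⟩
      refine ⟨?_, h1, h2, h3, h4⟩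
      rw [h1, h2, h3, h4]; exact hc
  · simp only [Set.mem_empty_iff_false, iff_false]
    rintro ⟨hW, h1, h2, h3, h4⟩
    rw [h1, h2, h3, h4] at hW
    exact hc hW

/-- **The core level probabilities of the square** as a sum over the `16` coin configurations. -/
theorem MixedCore.prob_level (h : MixedCore arcs s p q a c₁ c₂ c₃ c₄) (p' : E → R)
    (h12 : c₁ ≠ c₂) (h13 : c₁ ≠ c₃) (h14 : c₁ ≠ c₄) (h23 : c₂ ≠ c₃) (h24 : c₂ ≠ c₄) (h34 : c₃ ≠ c₄)
    (W : Finset V) :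
    prob p' (coreLevel arcs s {p, q, a} W) = ∑ b : Bool × Bool × Bool × Bool,
      if (p ∈ W ↔ (b.1 = true ∨ (b.2.1 = true ∧ b.2.2.2 = true ∧ b.2.2.1 = true))) ∧
          (q ∈ W ↔ b.2.1 = true) ∧
          (a ∈ W ↔ ((b.1 = true ∧ b.2.2.1 = true) ∨ (b.2.1 = true ∧ b.2.2.2 = true)))
        then edgeFactor (p' c₁) b.1 * edgeFactor (p' c₂) b.2.1 * edgeFactor (p' c₃) b.2.2.1 *
          edgeFactor (p' c₄) b.2.2.2 else 0 := by
  rw [prob_eq_sum_cyl4 (c₁ := c₁) (c₂ := c₂) (c₃ := c₃) (c₄ := c₄)]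
  refine Finset.sum_congr rfl fun b _ => ?_
  rw [h.level_inter_cyl W b]
  split_ifs
  · exact prob_cyl4 p' h12 h13 h14 h23 h24 h34 b
  · simp [prob]

/-- `ν(∅) = (1 − α)(1 − β)`. -/
theorem MixedCore.nu_empty (h : MixedCore arcs s p q a c₁ c₂ c₃ c₄) (pr : E → R)
    (h12 : c₁ ≠ c₂) (h13 : c₁ ≠ c₃) (h14 : c₁ ≠ c₄) (h23 : c₂ ≠ c₃) (h24 : c₂ ≠ c₄) (h34 : c₃ ≠ c₄) :
    prob pr (coreLevel arcs s {p, q, a} ∅) = (1 - pr c₁) * (1 - pr c₂) := by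
  rw [h.prob_level pr h12 h13 h14 h23 h24 h34]
  simp [Fintype.sum_prod_type]
  ring

/-- `ν({p}) = α(1 − β)(1 − γ)`. -/
theorem MixedCore.nu_p (h : MixedCore arcs s p q a c₁ c₂ c₃ c₄) (pr : E → R)
    (h12 : c₁ ≠ c₂) (h13 : c₁ ≠ c₃) (h14 : c₁ ≠ c₄) (h23 : c₂ ≠ c₃) (h24 : c₂ ≠ c₄) (h34 : c₃ ≠ c₄) :
    prob pr (coreLevel arcs s {p, q, a} {p}) = pr c₁ * (1 - pr c₂) * (1 - pr c₃) := by
  rw [h.prob_level pr h12 h13 h14 h23 h24 h34]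
  simp [Fintype.sum_prod_type, h.pq.symm, h.pa.symm]
  ring

/-- `ν({q}) = (1 − α)β(1 − δ)`. -/
theorem MixedCore.nu_q (h : MixedCore arcs s p q a c₁ c₂ c₃ c₄) (pr : E → R)
    (h12 : c₁ ≠ c₂) (h13 : c₁ ≠ c₃) (h14 : c₁ ≠ c₄) (h23 : c₂ ≠ c₃) (h24 : c₂ ≠ c₄) (h34 : c₃ ≠ c₄) :
    prob pr (coreLevel arcs s {p, q, a} {q}) = (1 - pr c₁) * pr c₂ * (1 - pr c₄) := by
  rw [h.prob_level pr h12 h13 h14 h23 h24 h34]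
  simp [Fintype.sum_prod_type, h.pq, h.qa.symm]
  ring

/-- `ν({p, q}) = αβ(1 − γ)(1 − δ)`. -/
theorem MixedCore.nu_pq (h : MixedCore arcs s p q a c₁ c₂ c₃ c₄) (pr : E → R)
    (h12 : c₁ ≠ c₂) (h13 : c₁ ≠ c₃) (h14 : c₁ ≠ c₄) (h23 : c₂ ≠ c₃) (h24 : c₂ ≠ c₄) (h34 : c₃ ≠ c₄) :
    prob pr (coreLevel arcs s {p, q, a} {p, q}) = pr c₁ * pr c₂ * (1 - pr c₃) * (1 - pr c₄) := by
  rw [h.prob_level pr h12 h13 h14 h23 h24 h34]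
  simp [Fintype.sum_prod_type, h.pa.symm, h.qa.symm]

/-- `ν({a}) = 0`. -/
theorem MixedCore.nu_a (h : MixedCore arcs s p q a c₁ c₂ c₃ c₄) (pr : E → R)
    (h12 : c₁ ≠ c₂) (h13 : c₁ ≠ c₃) (h14 : c₁ ≠ c₄) (h23 : c₂ ≠ c₃) (h24 : c₂ ≠ c₄) (h34 : c₃ ≠ c₄) :
    prob pr (coreLevel arcs s {p, q, a} {a}) = 0 := by
  rw [h.prob_level pr h12 h13 h14 h23 h24 h34]
  simp [Fintype.sum_prod_type, h.pa, h.qa]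

/-- `ν({p, a}) = α(1 − β)γ`. -/
theorem MixedCore.nu_pa (h : MixedCore arcs s p q a c₁ c₂ c₃ c₄) (pr : E → R)
    (h12 : c₁ ≠ c₂) (h13 : c₁ ≠ c₃) (h14 : c₁ ≠ c₄) (h23 : c₂ ≠ c₃) (h24 : c₂ ≠ c₄) (h34 : c₃ ≠ c₄) :
    prob pr (coreLevel arcs s {p, q, a} {p, a}) = pr c₁ * (1 - pr c₂) * pr c₃ := by
  rw [h.prob_level pr h12 h13 h14 h23 h24 h34]
  simp [Fintype.sum_prod_type, h.pq.symm, h.qa]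
  ring

/-- `ν({q, a}) = (1 − α)β(1 − γ)δ`. -/
theorem MixedCore.nu_qa (h : MixedCore arcs s p q a c₁ c₂ c₃ c₄) (pr : E → R)
    (h12 : c₁ ≠ c₂) (h13 : c₁ ≠ c₃) (h14 : c₁ ≠ c₄) (h23 : c₂ ≠ c₃) (h24 : c₂ ≠ c₄) (h34 : c₃ ≠ c₄) :
    prob pr (coreLevel arcs s {p, q, a} {q, a}) = (1 - pr c₁) * pr c₂ * (1 - pr c₃) * pr c₄ := by
  rw [h.prob_level pr h12 h13 h14 h23 h24 h34]
  simp [Fintype.sum_prod_type, h.pq, h.pa]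

/-- `ν({p, q, a}) = αβ(γ + δ − γδ) + (1 − α)βγδ`. -/
theorem MixedCore.nu_pqa (h : MixedCore arcs s p q a c₁ c₂ c₃ c₄) (pr : E → R)
    (h12 : c₁ ≠ c₂) (h13 : c₁ ≠ c₃) (h14 : c₁ ≠ c₄) (h23 : c₂ ≠ c₃) (h24 : c₂ ≠ c₄) (h34 : c₃ ≠ c₄) :
    prob pr (coreLevel arcs s {p, q, a} {p, q, a}) =
      pr c₁ * pr c₂ * (pr c₃ + pr c₄ - pr c₃ * pr c₄) + (1 - pr c₁) * pr c₂ * pr c₃ * pr c₄ := by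
  rw [h.prob_level pr h12 h13 h14 h23 h24 h34]
  simp [Fintype.sum_prod_type]
  ring

end MixedLevels

end Summit.Ventures.PercRepro2.Coin
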